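import Summits.NavierStokesRegularity.NavierStokesRegularity.Theorems.PerpetualPumpPumpTransferMajorantOfEnvelope
import Summits.NavierStokesRegularity.NavierStokesRegularity.Theorems.PerpetualPumpAveragedTypeIBlowupTypeISum

/-!
# Crux `PerpetualPump.AveragedTypeIBlowup` (stmt-NavierStokesRegularity-1835), line `Sketch`:
# stub `typeIOfTube` — the Type-I functional of a staircase

T. Tao, *Finite time blowup for an averaged three-dimensional Navier–Stokes equation*, J. Amer.
Math. Soc. **29** (2016), 601–674 = arXiv:1402.0290v3, §4 (4.8), p. 22 (4.14), §5: along the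
blowup staircase the solution stays Type-I. This file proves the registered stub `stub_typeIOfTube`
of `Cruxes/AveragedTypeIBlowup/Lines/Sketch.lean`, verbatim: for an ABSTRACT STAIRCASE (hand-off
times `τ_0 = 0 < τ_1 < ⋯ ↑ S`, pace `S - τ_k ≤ C_d (1+ε₀)^{-2k}`; on `[τ_k, τ_{k+1}]` the critical
variables `b_n = -(1+ε₀)^{n/2}Y_{0,n}`, `w_n = (1+ε₀)^{n/2}Y_{1,n}` of the modes `n ≤ k+1` bounded by
`C_b`, the modes `k+j`, `j ≥ 2`, under the ladder `ε̄ (1+ε₀)^{-19(j-2)}`; no modes below `0`) the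
crux's proxy `Φ(t) = Σ_{(i,n)} (1+ε₀)^{3n/2} (e^{-4π²(1+ε₀)^{2n}t}|A| 1_{(i,n)=(0,0)}
+ ∫₀ᵗ |quadTerm(Y)_{i,n}| e^{-4π²(1+ε₀)^{2n}(t-s)} ds)` is `≤ M/√(S-t)` on `[0,S)`.

Proof. Every `s ∈ [0,S)` lies in a stage `k'`, `k' ≤ k` when `s < τ_{k+1}`, so `|b_n|, |w_n| ≤ C_b`
at ALL modes and times and, before `τ_{k+1}`, every mode `n ≥ k+j`, `j ≥ 2`, is under
`ε̄ (1+ε₀)^{-19(j-2)}` (`typeIOfTube_bounds`). In terms of `Y` this is the scale envelope of the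
accepted `pumpMajorant_integral_quadTerm_le` (`…PumpTransferMajorantOfEnvelope.lean`): the Duhamel
integral of the band majorant of mode `(i,n)` is `≤ (C_α K²/4π²)(1+ε₀)^{-n/2} L`, `C_α = Σ|α|`;
`K = C_b`, `L = 1` gives the critical bound `(1+ε₀)^{n/2} F_{i,n} ≤ |A| + C_α C_b²/4π²` at every
scale, and `K = 1`, `L = ε̄(1+ε₀)^{-19(j-2)}` at `n = (k+1)+j`, `j ≥ 2`, the ladder decay
`≤ C₁ ((1+ε₀)^{-19})^j`, `C₁ = |A| + (C_α C_b²/4π²)(1+ε₀)^{38}` (the Toda form of `α` is not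
needed). The Type-I summation `typeIOfTube_sum` (Mathlib only; partial sums as in the accepted
`…TypeISum.lean`, geometric ratio `(1+ε₀)^{-18} ≤ 1 - ε₀/2` above the front `k+1`) gives
`3 C₁ (1+ε₀)^{k+3}/ε₀` per circuit index, and the pace `(1+ε₀)^k √(S-t) ≤ √C_d` gives
`Φ(t) ≤ M/√(S-t)`, `M = 6 C₁ (1+ε₀)³ √C_d/ε₀`. Nothing here closes the item (`--supports`).

## References

* T. Tao, J. Amer. Math. Soc. 29 (2016), 601–674, arXiv:1402.0290v3, §4 (4.8), p. 22 (4.14),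
  §5. [`Tao2016AveragedNS`]
-/

noncomputable section

-- the summit namespace `…NavierStokesRegularity.NavierStokesRegularity…` is the tree convention
set_option linter.dupNamespace false

open MeasureTheory Set Filter Topology Finset
open scoped ENNReal
open Literature.Analysis.FluidPDE
open Literature.Analysis.FluidPDE.TaoCascade (quadTerm shiftSet)
open Summit.NavierStokesRegularity.NavierStokesRegularity.Theorems.PerpetualPumpPumpTransfer
  (pumpMajorant_integral_quadTerm_le)

namespace Summit.NavierStokesRegularity.NavierStokesRegularity.Theorems.PerpetualPumpAveragedTypeIBlowup

variable {ε₀ : ℝ}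

/-- **The current stage.** If `τ 0 = 0 ≤ s < τ k` for some `k`, then `s` lies in a stage
`[τ k, τ (k+1))`, and `k < k'` whenever `s < τ k'` (the least `k'` with `s < τ k'`). [folklore] -/
theorem typeIOfTube_stage {τ : ℕ → ℝ} (hτ0 : τ 0 = 0) {s : ℝ} (hs : 0 ≤ s) (hex : ∃ k, s < τ k) :
    ∃ k : ℕ, τ k ≤ s ∧ s < τ (k + 1) ∧ ∀ k' : ℕ, s < τ k' → k < k' := by
  classical
  have h0 : Nat.find hex ≠ 0 := fun h => by
    have hspec := Nat.find_spec hex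
    rw [h, hτ0] at hspec
    exact absurd hspec (not_lt.2 hs)
  refine ⟨Nat.find hex - 1, ?_, ?_, fun k' hk' => ?_⟩
  · exact not_lt.1 (Nat.find_min hex (Nat.sub_lt (Nat.pos_of_ne_zero h0) one_pos))
  · rw [Nat.sub_add_cancel (Nat.one_le_iff_ne_zero.2 h0)]
    exact Nat.find_spec hex
  · have : Nat.find hex ≤ k' := Nat.find_min' hex hk'
    omega

/-- **Tube and ladder bounds at a time `s ∈ [0,S)`.** On the stage `k'` containing `s` the modes
`≤ k'+1` are under `C_b`, the modes `k'+j`, `j ≥ 2`, under `ε̄ (1+ε₀)^{-19(j-2)} ≤ ε̄ ≤ 1 ≤ C_b`; and if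
`s < τ (k+1)` then `k' ≤ k`, so a mode `n ≥ k + j` has relative level `n - k' ≥ j`. [folklore] -/
theorem typeIOfTube_bounds {εb Cb S : ℝ} (hL : 1 ≤ 1 + ε₀) (hεb : 0 ≤ εb) (hεb1 : εb ≤ 1)
    (hCb : 1 ≤ Cb) {bv wv : ℤ → ℝ → ℝ} {τ : ℕ → ℝ} (hτ0 : τ 0 = 0)
    (hex : ∀ t : ℝ, t < S → ∃ k, t < τ k)
    (htube : ∀ k : ℕ, ∀ t ∈ Icc (τ k) (τ (k + 1)),
        (∀ i : ℤ, i ≤ k + 1 → |bv i t| ≤ Cb ∧ |wv i t| ≤ Cb) ∧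
        (∀ j : ℕ, 2 ≤ j → |bv (k + j) t| ≤ εb * ((1 + ε₀) ^ (19 * (j - 2)))⁻¹ ∧
          |wv (k + j) t| ≤ εb * ((1 + ε₀) ^ (19 * (j - 2)))⁻¹))
    {s : ℝ} (hs : 0 ≤ s) (hsS : s < S) (n : ℤ) :
    (|bv n s| ≤ Cb ∧ |wv n s| ≤ Cb) ∧
      ∀ k j : ℕ, s < τ (k + 1) → 2 ≤ j → (k : ℤ) + j ≤ n →
        |bv n s| ≤ εb * ((1 + ε₀) ^ (19 * (j - 2)))⁻¹ ∧
          |wv n s| ≤ εb * ((1 + ε₀) ^ (19 * (j - 2)))⁻¹ := by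
  obtain ⟨k', hk1, hk2, hmin⟩ := typeIOfTube_stage hτ0 hs (hex s hsS)
  obtain ⟨h1, h2⟩ := htube k' s ⟨hk1, hk2.le⟩
  have hmono : ∀ {j j' : ℕ}, j ≤ j' →
      εb * ((1 + ε₀) ^ (19 * (j' - 2)))⁻¹ ≤ εb * ((1 + ε₀) ^ (19 * (j - 2)))⁻¹ := fun hjj' =>
    mul_le_mul_of_nonneg_left
      (inv_anti₀ (pow_pos (by linarith) _) (pow_le_pow_right₀ hL (by omega))) hεb
  have hCb' : ∀ j : ℕ, εb * ((1 + ε₀) ^ (19 * (j - 2)))⁻¹ ≤ Cb := fun j =>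
    (mul_le_mul_of_nonneg_left (inv_le_one_of_one_le₀ (one_le_pow₀ hL)) hεb).trans (by linarith)
  refine ⟨?_, fun k j hsk hj hn => ?_⟩
  · rcases le_or_gt n (k' + 1) with hn | hn
    · exact h1 n hn
    · obtain ⟨j, hj2, rfl⟩ : ∃ j : ℕ, 2 ≤ j ∧ (k' : ℤ) + (j : ℤ) = n :=
        ⟨(n - k').toNat, by omega, by omega⟩
      exact ⟨(h2 j hj2).1.trans (hCb' j), (h2 j hj2).2.trans (hCb' j)⟩
  · have hk'k : k' ≤ k := Nat.lt_succ_iff.1 (hmin _ hsk)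
    obtain ⟨j', hj', rfl⟩ : ∃ j' : ℕ, j ≤ j' ∧ (k' : ℤ) + (j' : ℤ) = n :=
      ⟨(n - k').toNat, by omega, by omega⟩
    have hb := h2 j' (hj.trans hj')
    exact ⟨hb.1.trans (hmono hj'), hb.2.trans (hmono hj')⟩

/-- **Critical variables to coefficients**: `|b_n(s)|, |w_n(s)| ≤ K L'` is the scale envelope
`|Y_{j,n}(s)| ≤ K (1+ε₀)^{-n/2} L'` (`j = 0, 1`) of `pumpMajorant_integral_quadTerm_le`. [folklore] -/
theorem typeIOfTube_coeff_le (hL : 0 < 1 + ε₀) {Y : Fin 2 → ℤ → ℝ → ℝ} {bv wv : ℤ → ℝ → ℝ}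
    (hbv : ∀ (n : ℤ) (t : ℝ), bv n t = -((1 + ε₀) ^ ((n : ℝ) / 2) * Y 0 n t))
    (hwv : ∀ (n : ℤ) (t : ℝ), wv n t = (1 + ε₀) ^ ((n : ℝ) / 2) * Y 1 n t)
    {n : ℤ} {s K L' : ℝ} (hb : |bv n s| ≤ K * L') (hw : |wv n s| ≤ K * L') (j : Fin 2) :
    |Y j n s| ≤ K * (1 + ε₀) ^ (-(n : ℝ) / 2) * L' := by
  have hP : 0 < (1 + ε₀) ^ ((n : ℝ) / 2) := Real.rpow_pos_of_pos hL _
  have key : ∀ y : ℝ, |(1 + ε₀) ^ ((n : ℝ) / 2) * y| ≤ K * L' →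
      |y| ≤ K * (1 + ε₀) ^ (-(n : ℝ) / 2) * L' := by
    intro y hy
    rw [abs_mul, abs_of_pos hP] at hy
    rw [neg_div, Real.rpow_neg hL.le, mul_right_comm, ← div_eq_mul_inv, le_div_iff₀ hP, mul_comm]
    exact hy
  revert j
  rw [Fin.forall_fin_two]
  exact ⟨key _ (by rwa [hbv, abs_neg] at hb), key _ (by rwa [hwv] at hw)⟩

/-- **The datum term is at most `|A|`**:
`(1+ε₀)^{n/2} e^{-4π²(1+ε₀)^{2n}t} |A| 1_{(i,n)=(0,0)} ≤ |A|` for `t ≥ 0`. [folklore] -/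
theorem typeIOfTube_datum_le (hε : 0 ≤ ε₀) {t : ℝ} (ht : 0 ≤ t) (A : ℝ) (i : Fin 2) (n : ℤ) :
    (1 + ε₀) ^ ((n : ℝ) / 2) * (Real.exp (-(4 * Real.pi ^ 2 * (1 + ε₀) ^ (2 * n) * t)) *
      (if i = 0 ∧ n = 0 then |A| else 0)) ≤ |A| := by
  have hL : 0 < 1 + ε₀ := by linarith
  split_ifs with h
  · obtain ⟨-, rfl⟩ := h
    simp only [Int.cast_zero, zero_div, Real.rpow_zero, one_mul]
    refine mul_le_of_le_one_left (abs_nonneg A) (Real.exp_le_one_iff.2 ?_)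
    exact neg_nonpos.2 (by positivity)
  · simp only [mul_zero]
    exact abs_nonneg A

/-- **Cancelling the critical weight**: `P (X P⁻¹ L') = X L'`, `P = (1+ε₀)^{n/2}`. [folklore] -/
theorem typeIOfTube_weight_cancel (hL : 0 < 1 + ε₀) (n : ℤ) (X L' : ℝ) :
    (1 + ε₀) ^ ((n : ℝ) / 2) * (X * (1 + ε₀) ^ (-(n : ℝ) / 2) * L') = X * L' := by
  have hP : (1 + ε₀) ^ ((n : ℝ) / 2) ≠ 0 := (Real.rpow_pos_of_pos hL _).ne'
  rw [neg_div, Real.rpow_neg hL.le]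
  calc (1 + ε₀) ^ ((n : ℝ) / 2) * (X * ((1 + ε₀) ^ ((n : ℝ) / 2))⁻¹ * L')
      = (1 + ε₀) ^ ((n : ℝ) / 2) * ((1 + ε₀) ^ ((n : ℝ) / 2))⁻¹ * (X * L') := by ring
    _ = X * L' := by rw [mul_inv_cancel₀ hP, one_mul]

/-- **High-scale partial sums under the ladder decay** (Mathlib only): if `ρ (1+ε₀)¹⁹ ≤ 1` and
`(1+ε₀)^{(n+j)/2} F_{n+j} ≤ C₁ ρ^j` for `j ≥ 2` then, with `r = (1+ε₀)⁻¹⁸ ≥ (1+ε₀)ρ`, `1 - r ≥ ε₀/2`,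
`∑_{m<i} (1+ε₀)^{3(n+2+m)/2} F_{n+2+m} ≤ C₁ (1+ε₀)ⁿ ∑_{m<i} r^m ≤ 2 C₁ (1+ε₀)ⁿ/ε₀`. [folklore] -/
theorem typeIOfTube_sum_high {C₁ ρ : ℝ} {F : ℤ → ℝ} {n : ℕ} (hε : 0 < ε₀) (hε1 : ε₀ ≤ 1)
    (hC : 0 ≤ C₁) (hρ : 0 ≤ ρ) (hρq : ρ * (1 + ε₀) ^ 19 ≤ 1)
    (hhigh : ∀ j : ℕ, 2 ≤ j →
      (1 + ε₀) ^ (((n + j : ℕ) : ℝ) / 2) * F ((n + j : ℕ) : ℤ) ≤ C₁ * ρ ^ j) (i : ℕ) :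
    ∑ m ∈ range i, (1 + ε₀) ^ ((3 : ℝ) * ((n + 2 + m : ℕ) : ℝ) / 2) * F ((n + 2 + m : ℕ) : ℤ) ≤
      2 * C₁ * (1 + ε₀) ^ n / ε₀ := by
  have hq : 1 ≤ 1 + ε₀ := by linarith
  have hq0 : 0 < 1 + ε₀ := by linarith
  obtain ⟨r, hr⟩ : ∃ r : ℝ, r = ((1 + ε₀) ^ 18)⁻¹ := ⟨_, rfl⟩
  have hr0 : 0 ≤ r := by rw [hr]; positivity
  have hqρ : (1 + ε₀) * ρ ≤ r := by
    rw [hr, ← one_div, le_div_iff₀ (pow_pos hq0 18)]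
    calc (1 + ε₀) * ρ * (1 + ε₀) ^ 18 = ρ * (1 + ε₀) ^ 19 := by ring
      _ ≤ 1 := hρq
  have h1r : ε₀ / 2 ≤ 1 - r := by
    have h1 : r ≤ (1 + ε₀)⁻¹ := hr ▸ inv_anti₀ hq0 (le_self_pow₀ hq (by norm_num))
    have h2 : (1 + ε₀)⁻¹ ≤ 1 - ε₀ / 2 := by rw [inv_eq_one_div, div_le_iff₀ hq0]; nlinarith
    linarith
  have hrlt : r < 1 := by linarith
  calc ∑ m ∈ range i, (1 + ε₀) ^ ((3 : ℝ) * ((n + 2 + m : ℕ) : ℝ) / 2) * F ((n + 2 + m : ℕ) : ℤ)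
      ≤ ∑ m ∈ range i, C₁ * (1 + ε₀) ^ n * r ^ m := by
        refine sum_le_sum fun m _ => ?_
        rw [show n + 2 + m = n + (m + 2) by omega, typeISum_rpow_split hq0, mul_assoc]
        calc (1 + ε₀) ^ (n + (m + 2)) *
              ((1 + ε₀) ^ (((n + (m + 2) : ℕ) : ℝ) / 2) * F ((n + (m + 2) : ℕ) : ℤ))
            ≤ (1 + ε₀) ^ (n + (m + 2)) * (C₁ * ρ ^ (m + 2)) :=
              mul_le_mul_of_nonneg_left (hhigh (m + 2) (by omega)) (pow_nonneg hq0.le _)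
          _ = C₁ * (1 + ε₀) ^ n * ((1 + ε₀) * ρ) ^ (m + 2) := by rw [pow_add, mul_pow]; ring
          _ ≤ C₁ * (1 + ε₀) ^ n * r ^ (m + 2) :=
              mul_le_mul_of_nonneg_left (pow_le_pow_left₀ (by positivity) hqρ _) (by positivity)
          _ ≤ C₁ * (1 + ε₀) ^ n * r ^ m :=
              mul_le_mul_of_nonneg_left (pow_le_pow_of_le_one hr0 hrlt.le (by omega))
                (by positivity)
    _ = C₁ * (1 + ε₀) ^ n * ∑ m ∈ range i, r ^ m := by rw [mul_sum]
    _ ≤ C₁ * (1 + ε₀) ^ n * (2 / ε₀) := by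
        refine mul_le_mul_of_nonneg_left ?_ (by positivity)
        calc ∑ m ∈ range i, r ^ m ≤ r ^ 0 / (1 - r) := by
              rw [range_eq_Ico]
              exact geom_sum_Ico_le_of_lt_one hr0 hrlt
          _ ≤ 1 / (ε₀ / 2) := by
              rw [pow_zero]
              exact one_div_le_one_div_of_le (by positivity) h1r
          _ = 2 / ε₀ := one_div_div ε₀ 2
    _ = 2 * C₁ * (1 + ε₀) ^ n / ε₀ := by ring

/-- **Type-I summation under the ladder decay** (Mathlib only; front `n : ℕ`, ratio
`ρ (1+ε₀)¹⁹ ≤ 1`): a `ℤ`-family of nonnegative band majorants, critically bounded up to one scale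
above the front, vanishing below `0` and `≤ C₁ ρ^j` at `n + j`, `j ≥ 2`, has `Σ_k (1+ε₀)^{3k/2} F_k
≤ 3 C₁ (1+ε₀)^{n+2}/ε₀` in `ℝ≥0∞` (supremum of the real partial sums, each split at `n + 2`:
`typeISum_sum_low` below, `typeIOfTube_sum_high` above). [folklore] -/
theorem typeIOfTube_sum (F : ℤ → ℝ) (n : ℕ) (C₁ ρ : ℝ) (hε : 0 < ε₀) (hε1 : ε₀ ≤ 1)
    (hC : 0 ≤ C₁) (hρ : 0 ≤ ρ) (hρq : ρ * (1 + ε₀) ^ 19 ≤ 1) (hF : ∀ k : ℤ, 0 ≤ F k)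
    (hF0 : ∀ k : ℤ, k < 0 → F k = 0)
    (hlow : ∀ k : ℤ, 0 ≤ k → k ≤ (n : ℤ) + 1 → (1 + ε₀) ^ ((k : ℝ) / 2) * F k ≤ C₁)
    (hhigh : ∀ j : ℕ, 2 ≤ j →
      (1 + ε₀) ^ (((n + j : ℕ) : ℝ) / 2) * F ((n + j : ℕ) : ℤ) ≤ C₁ * ρ ^ j) :
    ∑' k : ℤ, ENNReal.ofReal ((1 + ε₀) ^ ((3 : ℝ) * k / 2) * F k) ≤
      ENNReal.ofReal (3 * C₁ * (1 + ε₀) ^ (n + 2) / ε₀) := by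
  have hq : 0 < 1 + ε₀ := by linarith
  have hpart : ∀ i : ℕ, ∑ m ∈ range i, (1 + ε₀) ^ ((3 : ℝ) * m / 2) * F m ≤
      3 * C₁ * (1 + ε₀) ^ (n + 2) / ε₀ := by
    intro i
    have hnn : ∀ m ∈ range (n + 2 + i), m ∉ range i →
        0 ≤ (1 + ε₀) ^ ((3 : ℝ) * m / 2) * F m :=
      fun m _ _ => mul_nonneg (Real.rpow_nonneg hq.le _) (hF m)
    have hpow : (1 + ε₀) ^ n ≤ (1 + ε₀) ^ (n + 2) :=
      pow_le_pow_right₀ (by linarith : (1 : ℝ) ≤ 1 + ε₀) (by omega)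
    calc ∑ m ∈ range i, (1 + ε₀) ^ ((3 : ℝ) * m / 2) * F m
        ≤ ∑ m ∈ range (n + 2 + i), (1 + ε₀) ^ ((3 : ℝ) * m / 2) * F m :=
          sum_le_sum_of_subset_of_nonneg (range_mono (by omega)) hnn
      _ = ∑ m ∈ range (n + 2), (1 + ε₀) ^ ((3 : ℝ) * m / 2) * F m +
            ∑ m ∈ range i, (1 + ε₀) ^ ((3 : ℝ) * ((n + 2 + m : ℕ) : ℝ) / 2) *
              F ((n + 2 + m : ℕ) : ℤ) :=
          sum_range_add _ _ _
      _ ≤ C₁ * (1 + ε₀) ^ (n + 2) / ε₀ + 2 * C₁ * (1 + ε₀) ^ n / ε₀ :=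
          add_le_add (typeISum_sum_low hε hC hlow) (typeIOfTube_sum_high hε hε1 hC hρ hρq hhigh i)
      _ ≤ C₁ * (1 + ε₀) ^ (n + 2) / ε₀ + 2 * C₁ * (1 + ε₀) ^ (n + 2) / ε₀ := by gcongr
      _ = 3 * C₁ * (1 + ε₀) ^ (n + 2) / ε₀ := by ring
  -- the summand vanishes off the range of `Nat.cast : ℕ → ℤ`
  have hsupp : Function.support
      (fun k : ℤ => ENNReal.ofReal ((1 + ε₀) ^ ((3 : ℝ) * k / 2) * F k)) ⊆
        Set.range (Nat.cast : ℕ → ℤ) := by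
    intro k hk
    rw [Function.mem_support] at hk
    rcases lt_or_ge k 0 with h | h
    · exact (hk (by simp [hF0 k h])).elim
    · exact ⟨k.toNat, Int.toNat_of_nonneg h⟩
  calc ∑' k : ℤ, ENNReal.ofReal ((1 + ε₀) ^ ((3 : ℝ) * k / 2) * F k)
      = ∑' m : ℕ, ENNReal.ofReal ((1 + ε₀) ^ ((3 : ℝ) * ((m : ℤ) : ℝ) / 2) * F m) :=
        (Nat.cast_injective.tsum_eq hsupp).symm
    _ = ⨆ i : ℕ, ∑ m ∈ range i,
          ENNReal.ofReal ((1 + ε₀) ^ ((3 : ℝ) * ((m : ℤ) : ℝ) / 2) * F m) :=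
        ENNReal.tsum_eq_iSup_nat
    _ ≤ ENNReal.ofReal (3 * C₁ * (1 + ε₀) ^ (n + 2) / ε₀) := by
        refine iSup_le fun i => ?_
        rw [← ENNReal.ofReal_sum_of_nonneg fun (m : ℕ) _ =>
          mul_nonneg (Real.rpow_nonneg hq.le _) (hF m)]
        refine ENNReal.ofReal_le_ofReal ?_
        simp only [Int.cast_natCast]
        exact hpart i

/-- **Stub `typeIOfTube`** (tree vocabulary). THE TYPE-I FUNCTIONAL OF A STAIRCASE: if the hand-off
times `τ_k ↑ S` of an (abstract) staircase satisfy the pace `S − τ_k ≤ C_d(1+ε₀)^{-2k}` and on each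
stage `[τ_k, τ_{k+1}]` the critical variables of the modes `≤ k+1` are bounded by `C_b` while the
modes `k+j`, `j ≥ 2`, lie under the ladder profile, then the crux's `L^∞` proxy
`Σ_{i,n} (1+ε₀)^{3n/2}(e^{-4π²(1+ε₀)^{2n}t}|A|1_{(i,n)=(0,0)} + ∫₀ᵗ |quadTerm| e^{-4π²(1+ε₀)^{2n}(t-s)} ds)`
is `≤ M/√(S−t)` on `[0,S)` (scale envelope from the tube/ladder bounds ⇒ per-mode Duhamel bound
`pumpMajorant_integral_quadTerm_le` ⇒ `typeIOfTube_sum` at the front `k+1` ⇒ pace). (The Toda form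
of `α`, `0 < D_c`, `0 < S`, the strict monotonicity of `τ`, `τ_k < S` and the continuity of `Y`
belong to the registered signature and are not used: only `C_α = Σ|α| < ∞` matters.)
[cite: Tao2016AveragedNS, §4 (4.8), p. 22 (4.14); §5] -/
theorem stub_typeIOfTube :
    ∀ {ε₀ : ℝ}, 0 < ε₀ → ε₀ ≤ 1 / 20 → ∀ (Dc εb Cb Cd S A : ℝ) (Y : Fin 2 → ℤ → ℝ → ℝ)
      (α : Fin 2 → Fin 2 → Fin 2 → ℤ × ℤ × ℤ → ℝ) (bv wv : ℤ → ℝ → ℝ) (τ : ℕ → ℝ),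
      α = (fun (i₁ i₂ i₃ : Fin 2) (μ : ℤ × ℤ × ℤ) =>
          if i₁ = 1 ∧ i₂ = 1 ∧ i₃ = 0 ∧ μ = (0, 0, 0) then Dc else
          if i₁ = 1 ∧ i₂ = 0 ∧ i₃ = 1 ∧ μ = (0, 0, 0) then -Dc / 2 else
          if i₁ = 0 ∧ i₂ = 1 ∧ i₃ = 1 ∧ μ = (0, 0, 0) then -Dc / 2 else
          if i₁ = 1 ∧ i₂ = 0 ∧ i₃ = 1 ∧ μ = (0, 1, 0) then Dc / 2 else
          if i₁ = 0 ∧ i₂ = 1 ∧ i₃ = 1 ∧ μ = (1, 0, 0) then Dc / 2 else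
          if i₁ = 1 ∧ i₂ = 1 ∧ i₃ = 0 ∧ μ = (0, 0, 1) then -Dc else
          if i₁ = 0 ∧ i₂ = 0 ∧ i₃ = 1 ∧ μ = (0, 0, 0) then εb * Dc else
          if i₁ = 0 ∧ i₂ = 1 ∧ i₃ = 0 ∧ μ = (0, 0, 0) then -(εb * Dc) / 2 else
          if i₁ = 1 ∧ i₂ = 0 ∧ i₃ = 0 ∧ μ = (0, 0, 0) then -(εb * Dc) / 2 else 0) →
      0 < Dc → 0 < εb → εb ≤ 1 → 1 ≤ Cb → 0 < Cd → 0 < S →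
      (∀ (n : ℤ) (t : ℝ), bv n t = -((1 + ε₀) ^ ((n : ℝ) / 2) * Y 0 n t)) →
      (∀ (n : ℤ) (t : ℝ), wv n t = (1 + ε₀) ^ ((n : ℝ) / 2) * Y 1 n t) →
      (∀ i n t, n < 0 → Y i n t = 0) →
      τ 0 = 0 → StrictMono τ → (∀ k, τ k < S) → (∀ t : ℝ, t < S → ∃ k, t < τ k) →
      (∀ k : ℕ, S - τ k ≤ Cd * ((1 + ε₀) ^ (2 * k))⁻¹) →
      (∀ k : ℕ, ∀ t ∈ Icc (τ k) (τ (k + 1)),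
        (∀ i : ℤ, i ≤ k + 1 → |bv i t| ≤ Cb ∧ |wv i t| ≤ Cb) ∧
        (∀ j : ℕ, 2 ≤ j → |bv (k + j) t| ≤ εb * ((1 + ε₀) ^ (19 * (j - 2)))⁻¹ ∧
          |wv (k + j) t| ≤ εb * ((1 + ε₀) ^ (19 * (j - 2)))⁻¹)) →
      (∀ i n, ContinuousOn (Y i n) (Ico 0 S)) →
      ∃ M : ℝ, ∀ t ∈ Ico 0 S,
        (∑' p : Fin 2 × ℤ, ENNReal.ofReal ((1 + ε₀) ^ ((3 : ℝ) * p.2 / 2) *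
          (Real.exp (-(4 * Real.pi ^ 2 * (1 + ε₀) ^ (2 * p.2) * t)) *
              (if p.1 = 0 ∧ p.2 = 0 then |A| else 0) +
            ∫ s in (0 : ℝ)..t, |quadTerm ε₀ α Y p.1 p.2 s| *
              Real.exp (-(4 * Real.pi ^ 2 * (1 + ε₀) ^ (2 * p.2) * (t - s)))))) ≤
          ENNReal.ofReal (M / Real.sqrt (S - t)) := by
  intro ε₀ hε₀ hε₁ Dc εb Cb Cd S A Y α bv wv τ _hα _hDc hεb hεb1 hCb hCd _hS hbv hwv hlow hτ0 _hτ
    _hτS hex hpace htube _hYc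
  have hL : 0 < 1 + ε₀ := by linarith
  have hL1 : 1 ≤ 1 + ε₀ := by linarith
  have hε1 : ε₀ ≤ 1 := by linarith
  obtain ⟨Cα, hCα⟩ : ∃ C : ℝ,
      C = ∑ i₃ : Fin 2, ∑ i₁ : Fin 2, ∑ i₂ : Fin 2, ∑ μ ∈ shiftSet, |α i₁ i₂ i₃ μ| := ⟨_, rfl⟩
  have hCα0 : 0 ≤ Cα := by rw [hCα]; positivity
  obtain ⟨C₁, hC₁⟩ : ∃ C : ℝ, C = |A| + Cα * Cb ^ 2 / (4 * Real.pi ^ 2) * (1 + ε₀) ^ 38 :=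
    ⟨_, rfl⟩
  have hC₁0 : 0 ≤ C₁ := by rw [hC₁]; positivity
  refine ⟨2 * (3 * C₁ * (1 + ε₀) ^ 3 / ε₀) * Real.sqrt Cd, fun t ht => ?_⟩
  obtain ⟨k, hk1, hk2, -⟩ := typeIOfTube_stage hτ0 ht.1 (hex t ht.2)
  have hbd := fun (s : ℝ) (hs : s ∈ Icc 0 t) =>
    typeIOfTube_bounds hL1 hεb.le hεb1 hCb hτ0 hex htube hs.1 (hs.2.trans_lt ht.2)
  -- the Type-I sum of each circuit index: `typeIOfTube_sum` at the front `k + 1`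
  have key : ∀ i : Fin 2, ∑' n : ℤ, ENNReal.ofReal ((1 + ε₀) ^ ((3 : ℝ) * n / 2) *
      (Real.exp (-(4 * Real.pi ^ 2 * (1 + ε₀) ^ (2 * n) * t)) * (if i = 0 ∧ n = 0 then |A| else 0) +
        ∫ s in (0 : ℝ)..t, |quadTerm ε₀ α Y i n s| *
          Real.exp (-(4 * Real.pi ^ 2 * (1 + ε₀) ^ (2 * n) * (t - s))))) ≤
      ENNReal.ofReal (3 * C₁ * (1 + ε₀) ^ (k + 1 + 2) / ε₀) := by
    intro i
    refine typeIOfTube_sum _ (k + 1) C₁ ((1 + ε₀) ^ 19)⁻¹ hε₀ hε1 hC₁0 (by positivity)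
      (inv_mul_cancel₀ (pow_ne_zero _ hL.ne')).le ?_ ?_ ?_ ?_
    · intro n
      exact add_nonneg (mul_nonneg (Real.exp_nonneg _) (by positivity))
        (intervalIntegral.integral_nonneg ht.1 fun s _ =>
          mul_nonneg (abs_nonneg _) (Real.exp_nonneg _))
    · intro n hn
      have hq : ∀ s, quadTerm ε₀ α Y i n s = 0 := fun s => quadTerm_eq_zero_of_lt α hlow i hn s
      simp only [hq, abs_zero, zero_mul, intervalIntegral.integral_zero, add_zero]
      rw [if_neg (fun h => absurd h.2 (by omega)), mul_zero]
    · -- the critical bound at every scale (the tube bound `C_b` holds everywhere)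
      intro n _ _
      have hY : ∀ s ∈ Icc 0 t, ∀ (j : Fin 2) (n' : ℤ), n - 1 ≤ n' →
          |Y j n' s| ≤ Cb * (1 + ε₀) ^ (-(n' : ℝ) / 2) * 1 := fun s hs j n' _ =>
        typeIOfTube_coeff_le hL hbv hwv (by rw [mul_one]; exact ((hbd s hs n').1).1)
          (by rw [mul_one]; exact ((hbd s hs n').1).2) j
      have hI := pumpMajorant_integral_quadTerm_le hε₀.le α Y zero_le_one le_rfl ht.1 i n hY
      rw [← hCα] at hI; rw [mul_add]
      calc _ ≤ |A| + Cα * Cb ^ 2 / (4 * Real.pi ^ 2) * 1 :=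
            add_le_add (typeIOfTube_datum_le hε₀.le ht.1 A i n)
              ((mul_le_mul_of_nonneg_left hI (Real.rpow_nonneg hL.le _)).trans_eq
                (typeIOfTube_weight_cancel hL n _ 1))
        _ ≤ C₁ := by
            rw [hC₁, mul_one]
            have hX : 0 ≤ Cα * Cb ^ 2 / (4 * Real.pi ^ 2) := by positivity
            exact add_le_add le_rfl (le_mul_of_one_le_right hX (one_le_pow₀ hL1))
    · -- the ladder decay above the front `k + 1`
      intro j hj
      rw [(Int.cast_natCast (k + 1 + j)).symm, if_neg (fun h => absurd h.2 (by omega)), mul_zero,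
        zero_add]
      have hl0 : 0 ≤ εb * ((1 + ε₀) ^ (19 * (j - 2)))⁻¹ := by positivity
      have hl1 : εb * ((1 + ε₀) ^ (19 * (j - 2)))⁻¹ ≤ 1 :=
        (mul_le_mul_of_nonneg_left (inv_le_one_of_one_le₀ (one_le_pow₀ hL1)) hεb.le).trans
          (by linarith)
      have hY : ∀ s ∈ Icc 0 t, ∀ (j' : Fin 2) (n' : ℤ), ((k + 1 + j : ℕ) : ℤ) - 1 ≤ n' →
          |Y j' n' s| ≤ 1 * (1 + ε₀) ^ (-(n' : ℝ) / 2) * (εb * ((1 + ε₀) ^ (19 * (j - 2)))⁻¹) := by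
        intro s hs j' n' hn'
        have hb := (hbd s hs n').2 k j (hs.2.trans_lt hk2) hj (by push_cast at hn'; omega)
        exact typeIOfTube_coeff_le hL hbv hwv (by rw [one_mul]; exact hb.1)
          (by rw [one_mul]; exact hb.2) j'
      have hI := pumpMajorant_integral_quadTerm_le hε₀.le α Y hl0 hl1 ht.1 i _ hY
      rw [← hCα] at hI
      calc _ ≤ Cα * 1 ^ 2 / (4 * Real.pi ^ 2) * (εb * ((1 + ε₀) ^ (19 * (j - 2)))⁻¹) :=
            (mul_le_mul_of_nonneg_left hI (Real.rpow_nonneg hL.le _)).trans_eq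
              (typeIOfTube_weight_cancel hL _ _ _)
        _ ≤ Cα / (4 * Real.pi ^ 2) * (Cb ^ 2 * ((1 + ε₀) ^ (19 * (j - 2)))⁻¹) := by
            rw [one_pow, mul_one]
            refine mul_le_mul_of_nonneg_left (mul_le_mul_of_nonneg_right ?_ (by positivity))
              (by positivity)
            nlinarith
        _ = Cα * Cb ^ 2 / (4 * Real.pi ^ 2) * ((1 + ε₀) ^ 38 * (((1 + ε₀) ^ 19)⁻¹) ^ j) := by
            have hρj : (1 + ε₀) ^ 38 * (((1 + ε₀) ^ 19)⁻¹) ^ j = ((1 + ε₀) ^ (19 * (j - 2)))⁻¹ := by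
              rw [inv_pow, ← pow_mul, show 19 * j = 38 + 19 * (j - 2) by omega, pow_add, mul_inv,
                ← mul_assoc, mul_inv_cancel₀ (pow_ne_zero _ hL.ne'), one_mul]
            rw [hρj]; ring
        _ ≤ |A| * (((1 + ε₀) ^ 19)⁻¹) ^ j +
              Cα * Cb ^ 2 / (4 * Real.pi ^ 2) * ((1 + ε₀) ^ 38 * (((1 + ε₀) ^ 19)⁻¹) ^ j) :=
            le_add_of_nonneg_left (by positivity)
        _ = C₁ * (((1 + ε₀) ^ 19)⁻¹) ^ j := by rw [hC₁]; ring
  -- summing the two circuit indices and comparing with `M/√(S-t)` through the pace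
  have hB0 : 0 ≤ 3 * C₁ * (1 + ε₀) ^ (k + 1 + 2) / ε₀ := by positivity
  rw [ENNReal.tsum_prod', tsum_fintype, Fin.sum_univ_two]
  refine (add_le_add (key 0) (key 1)).trans ?_
  rw [← ENNReal.ofReal_add hB0 hB0]
  refine ENNReal.ofReal_le_ofReal ?_
  have hkey : (1 + ε₀) ^ k * Real.sqrt (S - t) ≤ Real.sqrt Cd := by
    refine Real.le_sqrt_of_sq_le ?_
    have h2k : 0 < (1 + ε₀) ^ (2 * k) := pow_pos hL _
    calc ((1 + ε₀) ^ k * Real.sqrt (S - t)) ^ 2 = (1 + ε₀) ^ (2 * k) * (S - t) := by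
          rw [mul_pow, Real.sq_sqrt (sub_nonneg.2 ht.2.le), ← pow_mul, mul_comm k 2]
      _ ≤ (1 + ε₀) ^ (2 * k) * (S - τ k) := mul_le_mul_of_nonneg_left (by linarith) h2k.le
      _ ≤ (1 + ε₀) ^ (2 * k) * (Cd * ((1 + ε₀) ^ (2 * k))⁻¹) :=
          mul_le_mul_of_nonneg_left (hpace k) h2k.le
      _ = Cd := by field_simp
  rw [le_div_iff₀ (Real.sqrt_pos.2 (sub_pos.2 ht.2))]
  calc (3 * C₁ * (1 + ε₀) ^ (k + 1 + 2) / ε₀ + 3 * C₁ * (1 + ε₀) ^ (k + 1 + 2) / ε₀) *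
        Real.sqrt (S - t)
      = 2 * (3 * C₁ * (1 + ε₀) ^ 3 / ε₀) * ((1 + ε₀) ^ k * Real.sqrt (S - t)) := by ring
    _ ≤ 2 * (3 * C₁ * (1 + ε₀) ^ 3 / ε₀) * Real.sqrt Cd :=
        mul_le_mul_of_nonneg_left hkey (by positivity)

end Summit.NavierStokesRegularity.NavierStokesRegularity.Theorems.PerpetualPumpAveragedTypeIBlowup

end
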